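import Literature.NumberTheory.PAdicHodge.BdRUnramified
import Literature.NumberTheory.PAdicHodge.AlgClosureToBdR
import Literature.NumberTheory.GaloisRepresentations.PotentiallyTrivialAdmissible
import HarnessLib

/-!
# Finite-image (potentially trivial) representations are de Rham — for Fontaine's `B_dR(F)`

Let `F` be a non-archimedean local field of characteristic `0` with `v(p) < 1`, and
`bdRPeriodRingData hp` Fontaine's field of `p`-adic periods `B_dR(F) = Frac B_dR⁺(F)` as a
period-ring datum (file `BdRPeriodRingData`: `B_dR^{Γ_F} = F`).  Combining

* the `Γ_F`-equivariant section `F̄ ↪ B_dR⁺(F)` of `θ` (file `AlgClosureToBdR`,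
  `algClosureToBdR`, Fontaine 1994, Exp. II 1.5.3), and
* `B`-admissibility of potentially trivial representations for every period ring receiving `F̄`
  equivariantly (file `GaloisRepresentations/PotentiallyTrivialAdmissible`,
  `PeriodRingData.isAdmissible_of_isOpen`: Hilbert 90 period matrix over a finite Galois `L/F`),

we obtain, for the GENUINE `B_dR(F)`, Fontaine's theorem **potentially trivial (in particular
finite-image, e.g. Artin) representations are de Rham** (Fontaine 1994, Exp. III §1.5–1.6 and
§3: `P̄`-admissible ⇒ `B_dR`-admissible; Fontaine–Mazur 1995 §1: finite-image local
representations are potentially unramified, hence potentially crystalline, hence de Rham):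

* `isAdmissible_bdR_of_isOpen` — `dim_F D_dR(V) = dim_{ℚ_p} V` for `V` trivial on an open subgroup;
* `FramedRep.isDeRhamWith_bdR_of_apply_eq_one`, `FramedRep.isDeRhamWith_bdR_of_finite_range` —
  the framed `ℚ̄_p`-valued forms (`FramedRep.IsDeRhamWith`, through a model over a finite `E/ℚ_p`,
  accepted `exists_hasQlModel_holds`);
* `PstWeilDeligneData.isDeRhamFramed_of_finite_range_of_bdR` — for every `p`-adic Hodge datum
  whose period ring is `bdRPeriodRingData hp` (for the datum's own `ℚ_p`-structure), finite-image
  `ρ : Γ_F →ₜ* GL_n(ℚ̄_p)` are `𝔇`-de Rham: the "Upgrade path" content of the stub of the crux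
  `IcosahedralSupply` of `Summits/Langlands` (the Doud–Moore even icosahedral representation at
  `ℓ = 1951 =` its conductor).

All statements hold for every `ℚ_p`-algebra structure on `F`.  Companion of `BdRUnramified`
(unramified ⇒ de Rham of weight `0`) and `BdRCyclotomic`.  No definitions, no named facts.

## References
* [FontaineAsterisque223III] J.-M. Fontaine, Astérisque 223 (1994), Exp. II §1.5.3, Exp. III §1.5–1.6, §3.
* [FontaineMazurGeometric1995] J.-M. Fontaine, B. Mazur, *Geometric Galois representations* (1995), §1.
* [SerreLocalFields1979] J.-P. Serre, *Local Fields*, Ch. X §1, Prop. 3 (Hilbert 90 for `GL_n`).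
-/

noncomputable section

open Field ValuativeRel
open scoped MatrixGroups

namespace Literature.NumberTheory.PAdicHodge

open Literature.NumberTheory.GaloisRepresentations
open Literature.NumberTheory.GaloisRepresentations.IsNonarchimedeanLocalField
open Literature.NumberTheory.Automorphic

variable {F : Type} [Field F] [ValuativeRel F] [TopologicalSpace F] [IsNonarchimedeanLocalField F]
  [CharZero F] {p : ℕ} [Fact p.Prime] [Fact (¬ IsUnit (p : integerC F))]
  [IsAdicComplete (Ideal.span {(p : integerC F)}) (integerC F)] [Algebra ℚ_[p] F]
  (hp : valuation F p < 1)

/-! ### `F̄ → B_dR` -/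

omit [Algebra ℚ_[p] F] in
/-- **`F̄ → B_dR(F)` is `Γ_F`-equivariant**: the section `F̄ ↪ B_dR⁺(F)` of `θ` followed by
`B_dR⁺ ⊆ B_dR`. [cite: FontaineAsterisque223III, Exp. II §1.5.3] -/
theorem smul_algClosureToFracBdR (σ : absoluteGaloisGroup F) (x : AlgebraicClosure F) :
    σ • ((algebraMap (BDeRhamPlus (integerC F) p) (FracBdR F p)).comp
        (algClosureToBdR hp (surjective_fontaineTheta_integerC hp))) x =
      ((algebraMap (BDeRhamPlus (integerC F) p) (FracBdR F p)).comp
        (algClosureToBdR hp (surjective_fontaineTheta_integerC hp))) (σ • x) := by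
  rw [RingHom.comp_apply, RingHom.comp_apply, smul_algebraMap_fracBdR, galBdRPlus_algClosureToBdR]

/-- `F̄ → B_dR(F)` extends the `F`-algebra map `F ↪ B_dR⁺ ⊆ B_dR` of `bdRPeriodRingData`. [folklore] -/
theorem algClosureToFracBdR_algebraMap (a : F) :
    ((algebraMap (BDeRhamPlus (integerC F) p) (FracBdR F p)).comp
        (algClosureToBdR hp (surjective_fontaineTheta_integerC hp))) (algebraMap F (AlgebraicClosure F) a) =
      algebraMap F (bdRPeriodRingData (F := F) (p := p) hp).B a := by
  rw [RingHom.comp_apply, algClosureToBdR_algebraMap,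
    algebraMap_bdRPeriodRingData (surjective_fontaineTheta_integerC hp) hp]

/-! ### Potentially trivial ⇒ de Rham -/

-- Mathlib's own global value of `maxSynthPendingDepth` (as in `isAdmissible_bdR_of_unramified`).
set_option maxSynthPendingDepth 3 in
/-- **Potentially trivial representations are de Rham**: for `B_dR(F)` (`bdRPeriodRingData`), every
continuous `ℚ_p`-linear representation of `Γ_F` on a finite-dimensional Hausdorff space which is
trivial on an open subgroup is admissible, `dim_F D_dR(V) = dim V` (the period ring receives `F̄`
equivariantly: `PeriodRingData.isAdmissible_of_isOpen` with `ι = (B_dR⁺ ⊆ B_dR) ∘ algClosureToBdR`).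
[cite: FontaineAsterisque223III, Exp. III §1.5 and §3] -/
theorem isAdmissible_bdR_of_isOpen
    {V : Type} [AddCommGroup V] [Module ℚ_[p] V] [TopologicalSpace V] [IsTopologicalAddGroup V]
    [ContinuousSMul ℚ_[p] V] [T2Space V] [FiniteDimensional ℚ_[p] V]
    (ρ : ContinuousRep (absoluteGaloisGroup F) ℚ_[p] V)
    (H : Subgroup (absoluteGaloisGroup F)) (hH : IsOpen (H : Set (absoluteGaloisGroup F)))
    (hρ : ∀ σ ∈ H, ∀ v : V, ρ σ v = v) :
    (bdRPeriodRingData (F := F) (p := p) hp).IsAdmissible ρ :=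
  PeriodRingData.isAdmissible_of_isOpen (bdRPeriodRingData hp)
    ((algebraMap (BDeRhamPlus (integerC F) p) (FracBdR F p)).comp
      (algClosureToBdR hp (surjective_fontaineTheta_integerC hp)))
    (fun σ x => smul_algClosureToFracBdR hp σ x) (fun a => algClosureToFracBdR_algebraMap hp a) ρ H hH hρ

omit [ValuativeRel F] [TopologicalSpace F] [IsNonarchimedeanLocalField F] [CharZero F]
  [Fact (¬ IsUnit (p : integerC F))] [IsAdicComplete (Ideal.span {(p : integerC F)}) (integerC F)]
  [Algebra ℚ_[p] F] in
/-- A model `rE` over `E ⊆ ℚ̄_p` of `ρ : Γ_F →ₜ* GL_n(ℚ̄_p)` is trivial wherever `ρ` is, and so is its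
underlying `ℚ_p`-linear representation. [folklore] -/
theorem restrictScalarsQl_apply_eq_self_of_apply_eq_one {n : ℕ}
    {ρ : FramedRep (absoluteGaloisGroup F) (PadicAlgCl p) n}
    {E : IntermediateField ℚ_[p] (PadicAlgCl p)} {rE : FramedRep (absoluteGaloisGroup F) E n}
    (h : HasQlModel ρ E rE) (σ : absoluteGaloisGroup F) (hσ : ρ σ = 1) (x : Fin n → E) :
    restrictScalarsQl E rE σ x = x := by
  obtain ⟨P, hP⟩ := h
  have h1 : FramedRep.conj P (rE.baseChange (algebraMap E (PadicAlgCl p)) continuous_subtype_val) σ = 1 := by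
    rw [hP]; exact hσ
  rw [FramedRep.conj_apply, mul_inv_eq_one, mul_eq_left] at h1
  have h2 : rE σ = 1 := by
    refine Units.ext (Matrix.ext fun i j => Subtype.val_injective ?_)
    have h3 := congrArg (fun g : GL (Fin n) (PadicAlgCl p) => (g : Matrix (Fin n) (Fin n) (PadicAlgCl p)) i j) h1
    simp only [FramedRep.baseChange_apply, Units.val_one] at h3
    change algebraMap E (PadicAlgCl p) (((rE σ : GL (Fin n) E) : Matrix (Fin n) (Fin n) E) i j) =
      (1 : Matrix (Fin n) (Fin n) (PadicAlgCl p)) i j at h3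
    change algebraMap E (PadicAlgCl p) (((rE σ : GL (Fin n) E) : Matrix (Fin n) (Fin n) E) i j) =
      algebraMap E (PadicAlgCl p) (((1 : GL (Fin n) E) : Matrix (Fin n) (Fin n) E) i j)
    rw [h3, Units.val_one, Matrix.one_apply, Matrix.one_apply]
    split_ifs <;> simp
  rw [restrictScalarsQl_apply_apply, FramedRep.toContinuousRep_apply_apply, h2, Units.val_one, Matrix.one_mulVec]

omit [ValuativeRel F] [TopologicalSpace F] [IsNonarchimedeanLocalField F] [CharZero F]
  [Fact (¬ IsUnit (p : integerC F))] [IsAdicComplete (Ideal.span {(p : integerC F)}) (integerC F)]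
  [Algebra ℚ_[p] F] in
/-- **The kernel of a finite-image `ρ : Γ_F →ₜ* GL_n(ℚ̄_p)` is open**: it is closed (`GL_n(ℚ̄_p)` is
Hausdorff) of finite index. [folklore] -/
theorem _root_.Literature.NumberTheory.GaloisRepresentations.FramedRep.isOpen_ker_of_finite_range {n : ℕ}
    (ρ : FramedRep (absoluteGaloisGroup F) (PadicAlgCl p) n) (hρ : (Set.range ρ).Finite) :
    IsOpen ((ρ.toMonoidHom.ker : Subgroup (absoluteGaloisGroup F)) : Set (absoluteGaloisGroup F)) := by
  haveI : Finite ρ.toMonoidHom.range := by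
    have h : (Set.range ρ.toMonoidHom).Finite := hρ
    exact h.to_subtype
  haveI : ρ.toMonoidHom.ker.FiniteIndex := by
    rw [Subgroup.finiteIndex_iff, Subgroup.index_ker]
    exact Nat.card_pos.ne'
  refine Subgroup.isOpen_of_isClosed_of_finiteIndex _ ?_
  rw [MonoidHom.coe_ker]
  exact isClosed_singleton.preimage ρ.continuous

-- Mathlib's own global value of `maxSynthPendingDepth`.
set_option maxSynthPendingDepth 3 in
/-- **`ρ : Γ_F →ₜ* GL_n(ℚ̄_p)` trivial on an open subgroup is de Rham** (for `B_dR(F)`): a finite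
model over `E/ℚ_p` (`exists_hasQlModel_holds`) is trivial on the same subgroup and its underlying
`ℚ_p`-linear representation is `B_dR`-admissible. [cite: FontaineAsterisque223III, Exp. III §1.5 and §3] -/
theorem _root_.Literature.NumberTheory.GaloisRepresentations.FramedRep.isDeRhamWith_bdR_of_apply_eq_one {n : ℕ}
    (ρ : FramedRep (absoluteGaloisGroup F) (PadicAlgCl p) n)
    (H : Subgroup (absoluteGaloisGroup F)) (hH : IsOpen (H : Set (absoluteGaloisGroup F)))
    (hρ : ∀ σ ∈ H, ρ σ = 1) :
    ρ.IsDeRhamWith ‹Algebra ℚ_[p] F› (bdRPeriodRingData (F := F) (p := p) hp) := by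
  obtain ⟨E, rE, hfin, hmodel⟩ := exists_hasQlModel_holds ρ
  haveI : FiniteDimensional ℚ_[p] E := hfin
  haveI : ContinuousSMul ℚ_[p] E := IntermediateField.continuousSMul_padicAlgCl E
  exact ⟨E, hfin, rE, hmodel, isAdmissible_bdR_of_isOpen hp (restrictScalarsQl E rE) H hH
    (fun σ hσ x => restrictScalarsQl_apply_eq_self_of_apply_eq_one hmodel σ (hρ σ hσ) x)⟩

/-- **Finite-image `ρ : Γ_F →ₜ* GL_n(ℚ̄_p)` (e.g. local Artin representations) are de Rham** (for
`B_dR(F)`): the kernel is an open subgroup on which `ρ` is trivial (Fontaine 1994, Exp. III §1.5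
and §3; Fontaine–Mazur 1995 §1: finite image ⇒ potentially unramified ⇒ de Rham).
[cite: FontaineAsterisque223III, Exp. III §1.5 and §3] [cite: FontaineMazurGeometric1995, §1] -/
theorem _root_.Literature.NumberTheory.GaloisRepresentations.FramedRep.isDeRhamWith_bdR_of_finite_range {n : ℕ}
    (ρ : FramedRep (absoluteGaloisGroup F) (PadicAlgCl p) n) (hρ : (Set.range ρ).Finite) :
    ρ.IsDeRhamWith ‹Algebra ℚ_[p] F› (bdRPeriodRingData (F := F) (p := p) hp) :=
  ρ.isDeRhamWith_bdR_of_apply_eq_one hp ρ.toMonoidHom.ker (ρ.isOpen_ker_of_finite_range hρ)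
    fun _ hσ => hσ

omit [Algebra ℚ_[p] F] in
/-- **Finite-image representations are `𝔇`-de Rham for every `p`-adic Hodge datum whose period
ring is `B_dR(F)`** (`𝔇.𝔅 = bdRPeriodRingData hp` for the datum's own `ℚ_p`-algebra structure) —
the content, for the genuine ring, of the Upgrade-path clause "finite-image (potentially
unramified) representations are de Rham" of `IsFontaineDatum` (file `FontaineDpst`).
[cite: FontaineAsterisque223III, Exp. III §1.5 and §3] [cite: FontaineMazurGeometric1995, §1] -/
theorem _root_.Literature.NumberTheory.GaloisRepresentations.PstWeilDeligneData.isDeRhamFramed_of_finite_range_of_bdR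
    (𝔇 : PstWeilDeligneData F p)
    (h𝔅 : 𝔇.𝔅 = (letI := 𝔇.algebra; bdRPeriodRingData (F := F) (p := p) hp)) {n : ℕ}
    (ρ : FramedRep (absoluteGaloisGroup F) (PadicAlgCl p) n) (hρ : (Set.range ρ).Finite) :
    𝔇.IsDeRhamFramed ρ := by
  letI := 𝔇.algebra
  show ρ.IsDeRhamWith 𝔇.algebra 𝔇.𝔅
  rw [h𝔅]
  exact ρ.isDeRhamWith_bdR_of_finite_range hp hρ

end Literature.NumberTheory.PAdicHodge

end
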